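import Mathlib
import HarnessLib
import Literature.Analysis.Calculus.SphereAngularRigidity
import Summits.Ventures.LatticeQCDFlow.Exactness.SphereLatticeGreen
import Summits.Ventures.LatticeQCDFlow.Exactness.SphereNLOFlowAction

/-!
# The null space of Lüscher's operator on the lattice of spheres is the constants: the flow actions `S̃⁽⁰⁾`, `S̃⁽¹⁾` are unique up to constants

HONEST FRAMING: exact (Metropolis-corrected) sampling algorithms for lattice gauge theory;
figures of merit are autocorrelation/cost numbers at stated couplings and volumes; no
continuum-physics claim.

Venture `LatticeQCDFlow` (cell pub-lqcd), topic `Exactness`; FANOUT row 7 (`s0-cpn-null`: the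
S0-D1 rung — 2D CP⁹, Lüscher's LO trivializing map inside HMC, Engel–Schaefer 2011).  NEW WORK of
the cell over Mathlib, the tree's `Exactness/SphereLatticeGreen.lean` (the lattice Green
identity: `𝔏₀ = −Σ_k ∂̃_k·∂̃_k` is symmetric, `⟨F, 𝔏₀F⟩ = Σ_k ∫‖∂̃_k F‖²`, `∫ 𝔏₀F = 0`),
`Exactness/SphereLOFlowAction.lean` (E–S eq. (15): `S̃⁽⁰⁾ = S/(2(d−1))` solves the LO equation),
`Exactness/SphereNLOFlowAction.lean` (`nlo_equation`: the closed-form `S̃⁽¹⁾` solves the order-`t¹`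
equation), `Exactness/SphereSiteLaplacianCalculus.lean` (linearity of `∂̃_k·∂̃_k`), and the
Literature support file `Literature/Analysis/Calculus/SphereAngularRigidity.lean`
(`eq_of_angDeriv_eq_zero_on_sphere`: vanishing angular derivatives force constancy on a sphere of
dimension `≥ 1`, [folklore]); nothing is cited as a fact.  Printed counterpart, NAMED ONLY:
M. Lüscher, Commun. Math. Phys. 293 (2010) 899, §3.3 (the null space of `𝔏₀` "consists of the
constant functions"; hence each order `S̃⁽ᵏ⁾` of the trivializing flow action is determined by
eqs. (3.9)–(3.12) up to an irrelevant additive constant, the constants `Ċ` being fixed by the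
normalisation of the measure); Engel–Schaefer, Comput. Phys. Commun. 182 (2011) 2107, §3 ("This
immediately leads to `S̃⁽⁰⁾ = S/(2(2N−1))`" — the present file says: and to nothing else).

## Content (`E` of dimension `d ≥ 2`, `Λ` finite, `P = ⊗_n σ` on `Λ → S(E)`, `F ∈ C²`)

* **`siteGrad_eq_zero_of_sum_siteLaplacian_eq_zero`** — `𝔏₀F = 0` on the product of unit spheres
  forces every natural gradient `∂̃_k F` to vanish there (energy identity + continuity + full
  support of `P`).
* **`apply_update_eq_of_siteGrad_eq_zero`**, **`eq_of_siteGrad_eq_zero`** — vanishing natural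
  gradients force `F` to be constant on the product of spheres (great circles site by site, then
  one site at a time across the lattice).
* **`eq_of_sum_siteLaplacian_eq_zero`** — THE NULL SPACE OF `𝔏₀` IS THE CONSTANTS.
* **`luscher_poisson_unique`** — UNIQUENESS FOR LÜSCHER'S RECURSION: two `C²` solutions of
  `𝔏₀X = R + c` (same source `R`, constants `c₁`, `c₂`) have `c₁ = c₂` and differ by a constant
  on the product of spheres — every order `S̃⁽ᵏ⁾` is determined up to a constant, and its `Ċ_k`
  is determined.
* `contDiff_localField`, `contDiff_esAction`, `contDiff_loFlowAction`, `contDiff_nloFlowAction`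
  (smoothness bookkeeping); **`integral_esAction`** — the mean of the action under `P` is `S₀`
  (`∫ S dP = S₀·P(univ)`, i.e. `⟨x_n·J_n⟩₀ = 0`, read off E–S (15) and `∫ 𝔏₀ = 0`);
  **`loFlowAction_unique`** — any `C²` solution of `−Σ∂̃²S̃ = S + C` has `C = −S₀` and
  `S̃ = S/(2(d−1)) + const` on the product of spheres; **`nloFlowAction_unique`** — any `C²`
  solution of the order-`t¹` equation `−Σ∂̃²S̃' + Σ⟨∂̃S, ∂̃S̃⁽⁰⁾⟩ = c` (isometric-or-zero couplings)
  has `c = (2κ²/d)·D` and `S̃' = S̃⁽¹⁾ + const`, `S̃⁽¹⁾` the closed form of `SphereNLOFlowAction`.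

NOT CLAIMED: existence of `S̃⁽ᵏ⁾` for `k ≥ 2` (only uniqueness is general here); the spectral
gap of `𝔏₀`; regularity below `C²`; anything quantitative.
-/

noncomputable section

namespace Summit.Ventures.LatticeQCDFlow.Exactness

open NormedSpace Function MeasureTheory Metric InnerProductSpace Laplacian Filter Set
open Literature.Analysis.Calculus
open scoped RealInnerProductSpace Topology Gradient ENNReal

variable {E : Type*} [NormedAddCommGroup E] [InnerProductSpace ℝ E]
variable {Λ : Type*} [Fintype Λ] [DecidableEq Λ]

/-! ## §1 `𝔏₀F = 0` forces the natural gradients to vanish -/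

section Gradients

variable [FiniteDimensional ℝ E] [MeasurableSpace E] [BorelSpace E] [Nontrivial E]

/-- **`𝔏₀F = 0` on the product of unit spheres forces `∂̃_k F = 0` there**, for `F ∈ C²`:
`0 = ⟨F, 𝔏₀F⟩ = Σ_k ∫ ‖∂̃_k F‖² dP`, the integrands are continuous and nonnegative and `P` charges
every open set. -/
theorem siteGrad_eq_zero_of_sum_siteLaplacian_eq_zero {F : (Λ → E) → ℝ} (hF : ContDiff ℝ 2 F)
    (h0 : ∀ ω : Λ → sphere (0 : E) 1, ∑ k, siteLaplacian k F (fun n => (ω n : E)) = 0) (k : Λ)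
    (ω : Λ → sphere (0 : E) 1) : siteGrad k F (fun n => (ω n : E)) = 0 := by
  have hE := integral_mul_neg_sum_siteLaplacian_self (Λ := Λ) hF
  have hL : ∫ ω, F (fun n => (ω n : E)) * -∑ k, siteLaplacian k F (fun n => (ω n : E))
      ∂Measure.pi (fun _ : Λ => (volume : Measure E).toSphere) = 0 := by
    simp [h0]
  rw [hL] at hE
  have hnn : ∀ k, 0 ≤ ∫ ω, ‖siteGrad k F (fun n => (ω n : E))‖ ^ 2
      ∂Measure.pi (fun _ : Λ => (volume : Measure E).toSphere) :=
    fun k => integral_nonneg fun ω => sq_nonneg _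
  have hk := (Finset.sum_eq_zero_iff_of_nonneg fun k _ => hnn k).1 hE.symm k (Finset.mem_univ k)
  have hcont : Continuous fun ω : Λ → sphere (0 : E) 1 =>
      ‖siteGrad k F (fun n => (ω n : E))‖ ^ 2 :=
    ((continuous_siteGrad_sphereConfig (hF.of_le (by norm_num)) k).norm).pow 2
  have hint := integrable_pi_toSphere_of_continuous (Λ := Λ) hcont
  have hae := (integral_eq_zero_iff_of_nonneg (fun ω => sq_nonneg _) hint).1 hk
  haveI := Measure.pi.isOpenPosMeasure (fun _ : Λ => (volume : Measure E).toSphere)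
  have hzero := (Continuous.ae_eq_iff_eq (Measure.pi fun _ : Λ => (volume : Measure E).toSphere)
    hcont (continuous_const : Continuous fun _ : Λ → sphere (0 : E) 1 => (0 : ℝ))).1 hae
  have h' : ‖siteGrad k F (fun n => (ω n : E))‖ ^ 2 = 0 := congrFun hzero ω
  exact norm_eq_zero.1 ((pow_eq_zero_iff two_ne_zero).1 h')

end Gradients

/-! ## §2 Vanishing natural gradients force constancy on the product of spheres (`d ≥ 2`) -/

section Constancy

variable [FiniteDimensional ℝ E]

/-- **One site**: if `∂̃_k F` vanishes along the `k`-th site sphere through `ω` (all other sites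
frozen), then `F` does not depend on site `k` there: `F(ω[k ← v]) = F(ω)` (`dim E ≥ 2`: any two
points of the site sphere lie on a great circle, along which `F` has zero derivative —
`Literature…eq_of_angDeriv_eq_zero_on_sphere`). -/
theorem apply_update_eq_of_siteGrad_eq_zero (h2 : 2 ≤ Module.finrank ℝ E) {F : (Λ → E) → ℝ}
    (hF : ContDiff ℝ 1 F) (k : Λ) (ω : Λ → sphere (0 : E) 1)
    (h : ∀ v : sphere (0 : E) 1, siteGrad k F (fun n => ((update ω k v) n : E)) = 0)
    (v : sphere (0 : E) 1) :
    F (fun n => ((update ω k v) n : E)) = F (fun n => (ω n : E)) := by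
  set b := stdOrthonormalBasis ℝ E
  -- the site section through `ω`
  have he : ContDiffOn ℝ 1 (fun y : E => F (update (fun n => (ω n : E)) k (normalize y))) {0}ᶜ :=
    contDiffOn_comp_update_normalize hF _ k
  -- its gradient on the unit sphere is the natural gradient, hence zero
  have hgrad : ∀ u : E, ‖u‖ = 1 →
      fderiv ℝ (fun y : E => F (update (fun n => (ω n : E)) k (normalize y))) u = 0 := by
    intro u hu
    have hu' : u ∈ sphere (0 : E) 1 := by simp [hu]
    have h1 := h ⟨u, hu'⟩
    rw [sphereConfig_update, siteGrad] at h1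
    simp only [update_idem, update_self] at h1
    rw [gradient] at h1
    exact (toDual ℝ E).symm.map_eq_zero_iff.1 h1
  have hang : ∀ i j (u : E), ‖u‖ = 1 →
      angDeriv b i j (fun y : E => F (update (fun n => (ω n : E)) k (normalize y))) u = 0 := by
    intro i j u hu
    simp [angDeriv_apply, hgrad u hu]
  have key := eq_of_angDeriv_eq_zero_on_sphere h2 b he one_pos hang
    (norm_eq_of_mem_sphere v) (norm_eq_of_mem_sphere (ω k))
  have hν : ∀ w : sphere (0 : E) 1, normalize (w : E) = w := fun w =>
    normalize_eq_self_of_norm_eq_one (norm_eq_of_mem_sphere w)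
  simp only [hν, update_eq_self] at key
  rw [sphereConfig_update]
  exact key

/-- **Across the lattice**: if every natural gradient `∂̃_k F` vanishes on the product of unit
spheres then `F` is constant there (change one site at a time). -/
theorem eq_of_siteGrad_eq_zero (h2 : 2 ≤ Module.finrank ℝ E) {F : (Λ → E) → ℝ}
    (hF : ContDiff ℝ 1 F)
    (h : ∀ (k : Λ) (ω : Λ → sphere (0 : E) 1), siteGrad k F (fun n => (ω n : E)) = 0)
    (ω ω' : Λ → sphere (0 : E) 1) : F (fun n => (ω n : E)) = F (fun n => (ω' n : E)) := by
  -- replace the sites of `ω` by those of `ω'` one at a time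
  have step : ∀ s : Finset Λ,
      F (fun n => ((s.piecewise ω' ω) n : E)) = F (fun n => (ω n : E)) := by
    intro s
    induction s using Finset.induction_on with
    | empty => simp
    | insert a s ha ih =>
      rw [Finset.piecewise_insert, apply_update_eq_of_siteGrad_eq_zero h2 hF a _ (fun v => h a _)]
      exact ih
  have huniv : (Finset.univ.piecewise ω' ω : Λ → sphere (0 : E) 1) = ω' := by
    funext n; exact Finset.piecewise_eq_of_mem _ _ _ (Finset.mem_univ n)
  rw [← step Finset.univ, huniv]

variable [MeasurableSpace E] [BorelSpace E]

/-- **The null space of Lüscher's operator is the constants.**  For `dim E ≥ 2` and `F ∈ C²`: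
if `Σ_k ∂̃_k·∂̃_k F = 0` on the product of unit spheres then `F` is constant there. -/
theorem eq_of_sum_siteLaplacian_eq_zero (h2 : 2 ≤ Module.finrank ℝ E) {F : (Λ → E) → ℝ}
    (hF : ContDiff ℝ 2 F)
    (h0 : ∀ ω : Λ → sphere (0 : E) 1, ∑ k, siteLaplacian k F (fun n => (ω n : E)) = 0)
    (ω ω' : Λ → sphere (0 : E) 1) : F (fun n => (ω n : E)) = F (fun n => (ω' n : E)) := by
  haveI : Nontrivial E := Module.nontrivial_of_finrank_pos (R := ℝ) (by omega)
  exact eq_of_siteGrad_eq_zero h2 (hF.of_le (by norm_num))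
    (fun k ω => siteGrad_eq_zero_of_sum_siteLaplacian_eq_zero hF h0 k ω) ω ω'

end Constancy

/-! ## §3 Uniqueness for Lüscher's recursion `𝔏₀X = R + Ċ` -/

section Uniqueness

variable [FiniteDimensional ℝ E] [MeasurableSpace E] [BorelSpace E]

omit [DecidableEq Λ] in
/-- The product of the sphere measures has nonzero, finite total mass (`dim E ≥ 1`). -/
theorem pi_toSphere_univ_toReal_ne_zero [Nontrivial E] :
    ((Measure.pi fun _ : Λ => (volume : Measure E).toSphere) univ).toReal ≠ 0 := by
  rw [ENNReal.toReal_ne_zero]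
  refine ⟨?_, measure_ne_top _ _⟩
  rw [Measure.pi_univ]
  exact Finset.prod_ne_zero_iff.2 fun _ _ => volume_toSphere_univ_ne_zero

/-- **Uniqueness for Lüscher's recursion.**  For `dim E ≥ 2`: if `X₁, X₂ ∈ C²` solve
`−Σ_k ∂̃_k·∂̃_k Xᵢ = R + cᵢ` on the product of unit spheres with the same source `R`, then
`c₁ = c₂` (integrate: `∫ 𝔏₀Xᵢ dP = 0`) and `X₁ − X₂` is constant there (null space of `𝔏₀`).
Every order `S̃⁽ᵏ⁾` of the trivializing flow action, and its constant `Ċ_k`, is thus determined by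
the lower orders up to an additive constant. -/
theorem luscher_poisson_unique (h2 : 2 ≤ Module.finrank ℝ E) {X₁ X₂ R : (Λ → E) → ℝ}
    (hX₁ : ContDiff ℝ 2 X₁) (hX₂ : ContDiff ℝ 2 X₂) {c₁ c₂ : ℝ}
    (h₁ : ∀ ω : Λ → sphere (0 : E) 1,
      -∑ k, siteLaplacian k X₁ (fun n => (ω n : E)) = R (fun n => (ω n : E)) + c₁)
    (h₂ : ∀ ω : Λ → sphere (0 : E) 1,
      -∑ k, siteLaplacian k X₂ (fun n => (ω n : E)) = R (fun n => (ω n : E)) + c₂) :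
    c₁ = c₂ ∧ ∀ ω ω' : Λ → sphere (0 : E) 1,
      X₁ (fun n => (ω n : E)) - X₂ (fun n => (ω n : E)) =
        X₁ (fun n => (ω' n : E)) - X₂ (fun n => (ω' n : E)) := by
  haveI : Nontrivial E := Module.nontrivial_of_finrank_pos (R := ℝ) (by omega)
  -- the difference of the two Laplacians is the constant `c₂ − c₁`
  have hdiff : ∀ ω : Λ → sphere (0 : E) 1,
      ∑ k, siteLaplacian k X₁ (fun n => (ω n : E)) - ∑ k, siteLaplacian k X₂ (fun n => (ω n : E)) =
        c₂ - c₁ := fun ω => by linarith [h₁ ω, h₂ ω]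
  -- (1) the constants agree: integrate, `∫ 𝔏₀Xᵢ = 0`
  have hc : c₁ = c₂ := by
    have i₁ := integral_sum_siteLaplacian_eq_zero (Λ := Λ) hX₁
    have i₂ := integral_sum_siteLaplacian_eq_zero (Λ := Λ) hX₂
    have hint₁ := integrable_pi_toSphere_of_continuous (Λ := Λ) (E := E)
      (continuous_finsetSum Finset.univ fun k _ => continuous_siteLaplacian_sphereConfig hX₁ k)
    have hint₂ := integrable_pi_toSphere_of_continuous (Λ := Λ) (E := E)
      (continuous_finsetSum Finset.univ fun k _ => continuous_siteLaplacian_sphereConfig hX₂ k)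
    have hsub := integral_sub hint₁ hint₂
    rw [i₁, i₂, sub_zero] at hsub
    simp_rw [hdiff] at hsub
    rw [integral_const, smul_eq_mul, Measure.real] at hsub
    have hm := pi_toSphere_univ_toReal_ne_zero (Λ := Λ) (E := E)
    have : c₂ - c₁ = 0 := by
      by_contra hne
      exact (mul_ne_zero hm hne) hsub
    linarith
  refine ⟨hc, ?_⟩
  -- (2) the difference lies in the null space of `𝔏₀`
  subst hc
  have hD : ContDiff ℝ 2 (fun x => X₁ x - X₂ x) := hX₁.sub hX₂
  have hD0 : ∀ ω : Λ → sphere (0 : E) 1,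
      ∑ k, siteLaplacian k (fun x => X₁ x - X₂ x) (fun n => (ω n : E)) = 0 := by
    intro ω
    have hk : ∀ k, siteLaplacian k (fun x => X₁ x - X₂ x) (fun n => (ω n : E)) =
        siteLaplacian k X₁ (fun n => (ω n : E)) - siteLaplacian k X₂ (fun n => (ω n : E)) :=
      fun k => siteLaplacian_sub (sphereConfig_ne_zero ω k)
        (hX₁.comp (contDiff_update 2 _ k)) (hX₂.comp (contDiff_update 2 _ k))
    simp_rw [hk, Finset.sum_sub_distrib, hdiff ω, sub_self]
  exact eq_of_sum_siteLaplacian_eq_zero h2 hD hD0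

end Uniqueness

/-! ## §4 The Engel–Schaefer actions: smoothness, the mean of the action, uniqueness of `S̃⁽⁰⁾` and `S̃⁽¹⁾` -/

section EngelSchaefer

variable (U : Λ → Λ → (E →L[ℝ] E))

omit [DecidableEq Λ] in
/-- The local field `J_n` is smooth (linear) in the configuration. -/
theorem contDiff_localField (n : Λ) {m : WithTop ℕ∞} : ContDiff ℝ m (localField U n) := by
  unfold localField
  exact ContDiff.sum fun k _ => (U n k).contDiff.comp (contDiff_apply ℝ E k)

omit [DecidableEq Λ] in
/-- The action `S = −κ Σ_n ⟪x_n, J_n⟫ + S₀` is smooth (a polynomial) in the configuration. -/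
theorem contDiff_esAction (κ S₀ : ℝ) {m : WithTop ℕ∞} : ContDiff ℝ m (esAction κ S₀ U) := by
  unfold esAction
  exact (contDiff_const.mul (ContDiff.sum fun n _ =>
    (contDiff_apply ℝ E n).inner ℝ (contDiff_localField U n))).add contDiff_const

omit [DecidableEq Λ] in
/-- The leading-order flow action `S̃⁽⁰⁾ = S/(2(d−1))` is smooth in the configuration. -/
theorem contDiff_loFlowAction (κ S₀ : ℝ) {m : WithTop ℕ∞} : ContDiff ℝ m (loFlowAction κ S₀ U) := by
  unfold loFlowAction
  exact contDiff_const.mul (contDiff_esAction U κ S₀)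

/-- The next-to-leading-order flow action `S̃⁽¹⁾` is of class `C²` in the configuration. -/
theorem contDiff_nloFlowAction (κ : ℝ) : ContDiff ℝ 2 (nloFlowAction κ U) := by
  obtain ⟨hA, hB, hC⟩ := contDiff_sums (E := E) U
  unfold nloFlowAction nloPotential
  exact contDiff_const.mul (((contDiff_const.mul hA).sub (contDiff_const.mul hB)).sub
    (contDiff_const.mul hC))

variable {U} [FiniteDimensional ℝ E] [MeasurableSpace E] [BorelSpace E]

/-- **The mean of the action under the product measure is `S₀`** (`⟨x_n·J_n⟩₀ = 0`): for
couplings with no self-coupling and adjoint pairs and `dim E ≥ 2`,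
`∫ S dP = S₀ · P(univ)` — read off E–S eq. (15) (`S − S₀ = −Σ∂̃²S̃⁽⁰⁾`) and `∫ 𝔏₀F dP = 0`. -/
theorem integral_esAction (hU0 : ∀ n, U n n = 0)
    (hUadj : ∀ m n (v w : E), ⟪U m n v, w⟫ = ⟪v, U n m w⟫) (hd : 2 ≤ Module.finrank ℝ E)
    (κ S₀ : ℝ) :
    ∫ ω, esAction κ S₀ U (fun n => (ω n : E)) ∂Measure.pi (fun _ : Λ => (volume : Measure E).toSphere) =
      S₀ * ((Measure.pi fun _ : Λ => (volume : Measure E).toSphere) univ).toReal := by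
  haveI : Nontrivial E := Module.nontrivial_of_finrank_pos (R := ℝ) (by omega)
  have h15 : ∀ ω : Λ → sphere (0 : E) 1, esAction κ S₀ U (fun n => (ω n : E)) =
      -∑ k, siteLaplacian k (loFlowAction κ S₀ U) (fun n => (ω n : E)) + S₀ := fun ω => by
    rw [neg_sum_siteLaplacian_loFlowAction hU0 hUadj hd κ S₀ fun n => norm_eq_of_mem_sphere (ω n)]
    ring
  have hint := integrable_pi_toSphere_of_continuous (Λ := Λ) (E := E)
    (continuous_finsetSum Finset.univ fun k _ =>
      continuous_siteLaplacian_sphereConfig (contDiff_loFlowAction U κ S₀) k)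
  have hneg : Integrable (fun ω : Λ → sphere (0 : E) 1 =>
      -∑ k, siteLaplacian k (loFlowAction κ S₀ U) (fun n => (ω n : E)))
      (Measure.pi fun _ : Λ => (volume : Measure E).toSphere) := hint.neg
  simp_rw [h15]
  rw [integral_add hneg (integrable_const _), integral_neg,
    integral_sum_siteLaplacian_eq_zero (contDiff_loFlowAction U κ S₀), neg_zero, zero_add,
    integral_const, smul_eq_mul, Measure.real, mul_comm]

/-- **Uniqueness of the leading-order flow action (E–S eq. (15) has no other solution).**  For
`dim E ≥ 2`, no self-coupling and adjoint pairs: if `S̃ ∈ C²` satisfies Lüscher's LO equation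
`−Σ_k ∂̃_k·∂̃_k S̃ = S + C` on the product of unit spheres for some constant `C`, then `C = −S₀` and
`S̃ − S/(2(d−1))` is constant there. -/
theorem loFlowAction_unique (hU0 : ∀ n, U n n = 0)
    (hUadj : ∀ m n (v w : E), ⟪U m n v, w⟫ = ⟪v, U n m w⟫) (hd : 2 ≤ Module.finrank ℝ E)
    (κ S₀ : ℝ) {St : (Λ → E) → ℝ} (hSt : ContDiff ℝ 2 St) {C : ℝ}
    (hLO : ∀ ω : Λ → sphere (0 : E) 1,
      -∑ k, siteLaplacian k St (fun n => (ω n : E)) = esAction κ S₀ U (fun n => (ω n : E)) + C) :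
    C = -S₀ ∧ ∀ ω ω' : Λ → sphere (0 : E) 1,
      St (fun n => (ω n : E)) - loFlowAction κ S₀ U (fun n => (ω n : E)) =
        St (fun n => (ω' n : E)) - loFlowAction κ S₀ U (fun n => (ω' n : E)) := by
  have h15 : ∀ ω : Λ → sphere (0 : E) 1,
      -∑ k, siteLaplacian k (loFlowAction κ S₀ U) (fun n => (ω n : E)) =
        esAction κ S₀ U (fun n => (ω n : E)) + -S₀ := fun ω => by
    rw [neg_sum_siteLaplacian_loFlowAction hU0 hUadj hd κ S₀ fun n => norm_eq_of_mem_sphere (ω n)]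
    ring
  exact luscher_poisson_unique hd hSt (contDiff_loFlowAction U κ S₀) hLO h15

/-- **Uniqueness of the next-to-leading-order flow action.**  For `dim E ≥ 2`, no self-coupling,
adjoint pairs and isometric-or-zero couplings (so that `D = Σ‖U_{nm}x_m‖²` is a constant of the
lattice): if `S̃' ∈ C²` satisfies Lüscher's order-`t¹` equation
`−Σ_k ∂̃_k·∂̃_k S̃' + Σ_k ⟪∂̃_k S, ∂̃_k S̃⁽⁰⁾⟫ = c` on the product of unit spheres for some constant `c`,
then `c = (2κ²/d)·D` and `S̃' − S̃⁽¹⁾` is constant there, `S̃⁽¹⁾ = nloFlowAction κ U` the closed form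
`−(2κ²/(d−1))[A/(2d−1) − B/(4d−2) − C/(4d)]` of `SphereNLOFlowAction`. -/
theorem nloFlowAction_unique (hU0 : ∀ n, U n n = 0)
    (hUadj : ∀ m n (v w : E), ⟪U m n v, w⟫ = ⟪v, U n m w⟫)
    (hIso : ∀ n m, U n m = 0 ∨ ∀ v, ‖U n m v‖ = ‖v‖) (hd : 2 ≤ Module.finrank ℝ E)
    (κ S₀ : ℝ) {St : (Λ → E) → ℝ} (hSt : ContDiff ℝ 2 St) {c : ℝ}
    (hNLO : ∀ ω : Λ → sphere (0 : E) 1,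
      -∑ k, siteLaplacian k St (fun n => (ω n : E)) +
        ∑ k, ⟪siteGrad k (esAction κ S₀ U) (fun n => (ω n : E)),
          siteGrad k (loFlowAction κ S₀ U) (fun n => (ω n : E))⟫ = c)
    (ω₀ : Λ → sphere (0 : E) 1) :
    c = 2 * κ ^ 2 / (Module.finrank ℝ E : ℝ) * normSum U (fun n => (ω₀ n : E)) ∧
      ∀ ω ω' : Λ → sphere (0 : E) 1,
        St (fun n => (ω n : E)) - nloFlowAction κ U (fun n => (ω n : E)) =
          St (fun n => (ω' n : E)) - nloFlowAction κ U (fun n => (ω' n : E)) := by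
  have hunit : ∀ (ω : Λ → sphere (0 : E) 1) (n : Λ), ‖(ω n : E)‖ = 1 := fun ω n =>
    norm_eq_of_mem_sphere (ω n)
  -- both `S̃'` and `S̃⁽¹⁾` solve `𝔏₀X = R + const` with `R = −Σ⟨∂̃S, ∂̃S̃⁽⁰⁾⟩`
  have h₁ : ∀ ω : Λ → sphere (0 : E) 1, -∑ k, siteLaplacian k St (fun n => (ω n : E)) =
      -∑ k, ⟪siteGrad k (esAction κ S₀ U) (fun n => (ω n : E)),
        siteGrad k (loFlowAction κ S₀ U) (fun n => (ω n : E))⟫ + c := fun ω => by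
    linarith [hNLO ω]
  have h₂ : ∀ ω : Λ → sphere (0 : E) 1,
      -∑ k, siteLaplacian k (nloFlowAction κ U) (fun n => (ω n : E)) =
        -∑ k, ⟪siteGrad k (esAction κ S₀ U) (fun n => (ω n : E)),
          siteGrad k (loFlowAction κ S₀ U) (fun n => (ω n : E))⟫ +
          2 * κ ^ 2 / (Module.finrank ℝ E : ℝ) * normSum U (fun n => (ω₀ n : E)) := fun ω => by
    rw [normSum_eq U hIso (hunit ω₀) (hunit ω)]
    linarith [nlo_equation hU0 hUadj hd κ S₀ (hunit ω)]
  exact luscher_poisson_unique hd hSt (contDiff_nloFlowAction U κ)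
    (R := fun x => -∑ k, ⟪siteGrad k (esAction κ S₀ U) x, siteGrad k (loFlowAction κ S₀ U) x⟫)
    h₁ h₂

end EngelSchaefer

end Summit.Ventures.LatticeQCDFlow.Exactness

end
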